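import Mathlib

/-!
# Line `near_straight_newton` · the exact rational straight datum (S1 witness) — one-variable facts, sorry-free

Crux `SkeletonJ1` (stmt-NavierStokesRegularity-27413) / cone successor `SkeletonJ1G` (stmt-NavierStokesRegularity-27849);
strategist seat planner-cstrat-stmt-NavierStokesRegularity-27413-s1-g2-0, 2026-08-28.

Design law (`Lines/near_straight_newton_design.md`): every `R_π` straight skew pair `p = (±d/2,0,0)`, `t = (0,±sin θ,cos θ)`,
`γ₁ = γ₂ = γ`, frame `½y − α e₃×y` has scaled slip `W(s) = (ε/2)·F(s/ε)` with `F(u) = κ₁/(1+u²) + u − κ₂`,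
`ε = d/sin 2θ`, `κ₁ = γ sin²2θ/(πd²)`, `κ₂ = α sin θ sin 2θ`.  The EXACT RATIONAL member `(κ₁, κ₂) = (125/3, 7/6)`
(`sin θ = 3/5`, `d = 4/25`, `γ = 125π/108`, `α = 875/432`, so `ε = 1/6`) gives `W(s) = (1/12)·F(6s)` with the zero at
`s₀ = −1/2` and slope `W′(s₀) = 7/4 = 3/2 + 1/4`.

This file proves, for that member, exactly the one-variable facts the predicate `StraightDatum` of
`Lines/near_straight_newton.lean` asks of each `W j` (zero, uniqueness, transversality `mw = 1/10`, slope `3/2 + δ` with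
`δ = 1/4`, global slope bound `Λ = 22`).  What it does NOT do (left to the S1 prover): the 3-vector reduction of the
predicate's `W j` to `(1/12)·F(6s)` for the explicit `p, t, γ, α` (cf. `…Theorems.SelectionBoxRJRung` tools for the 45° datum).
Route-independent real analysis; nothing here is a claim about Navier–Stokes regularity or blow-up.
-/

set_option linter.dupNamespace false

noncomputable section

namespace Summit.NavierStokesRegularity.NavierStokesRegularity.Cruxes.SkeletonJ1.NearStraightNewton

/-- The thin exact profile `F(u) = (125/3)/(1+u²) + u − 7/6`. -/
def Fthin (u : ℝ) : ℝ := 125 / 3 / (1 + u ^ 2) + u - 7 / 6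

/-- Its derivative `F′(u) = 1 − (250/3)·u/(1+u²)²`. -/
def Fthin' (u : ℝ) : ℝ := 1 - 250 / 3 * u / (1 + u ^ 2) ^ 2

/-- The scaled slip of the exact datum, `W(s) = (1/12)·F(6s)`. -/
def Wthin (s : ℝ) : ℝ := 1 / 12 * Fthin (6 * s)

/-! ### Zero and sign structure of `F` (no calculus needed) -/

/-- `F(−3) = 0` exactly. -/
theorem Fthin_neg_three : Fthin (-3) = 0 := by norm_num [Fthin]

/-- `F > 0` to the right of `−3`; quantitatively `F(u) ≥ u + 3` on `(−3, 3]` and `F(u) > u − 7/6` beyond. -/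
theorem Fthin_pos_of_gt {u : ℝ} (hu : -3 < u) : 0 < Fthin u := by
  have h1 : 0 < 1 + u ^ 2 := by positivity
  rcases le_or_gt u 3 with h3 | h3
  · have hsq : 1 + u ^ 2 ≤ 10 := by nlinarith
    have hb : 25 / 6 ≤ 125 / 3 / (1 + u ^ 2) := by
      rw [le_div_iff₀ h1]; nlinarith
    unfold Fthin; linarith
  · have hb : 0 < 125 / 3 / (1 + u ^ 2) := by positivity
    unfold Fthin; linarith

/-- `F < 0` to the left of `−3`. -/
theorem Fthin_neg_of_lt {u : ℝ} (hu : u < -3) : Fthin u < 0 := by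
  have h1 : 0 < 1 + u ^ 2 := by positivity
  have hsq : 10 < 1 + u ^ 2 := by nlinarith
  have hb : 125 / 3 / (1 + u ^ 2) < 25 / 6 := by
    rw [div_lt_iff₀ h1]; nlinarith
  unfold Fthin; linarith

/-- UNIQUE ZERO: `F(u) = 0 ↔ u = −3`. -/
theorem Fthin_eq_zero_iff {u : ℝ} : Fthin u = 0 ↔ u = -3 := by
  constructor
  · intro h
    by_contra hne
    rcases lt_or_gt_of_ne hne with hlt | hgt
    · exact absurd h (ne_of_lt (Fthin_neg_of_lt hlt))
    · exact absurd h (ne_of_gt (Fthin_pos_of_gt hgt))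
  · rintro rfl; exact Fthin_neg_three

/-- QUANTITATIVE TRANSVERSALITY: `|F(u)| ≥ |u + 3|/5` for all `u` (sharp constant ≈ 0.662). -/
theorem Fthin_transversal (u : ℝ) : |u + 3| / 5 ≤ |Fthin u| := by
  have h1 : 0 < 1 + u ^ 2 := by positivity
  rcases lt_or_ge u (-3) with hlt | hge
  · have hsq : 10 < 1 + u ^ 2 := by nlinarith
    have hb : 125 / 3 / (1 + u ^ 2) < 25 / 6 := by
      rw [div_lt_iff₀ h1]; nlinarith
    have hF : Fthin u < u + 3 := by unfold Fthin; linarith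
    rw [abs_of_neg (by linarith : u + 3 < 0), abs_of_neg (by linarith : Fthin u < 0)]
    linarith
  rcases le_or_gt u 3 with hle | hgt
  · have hsq : 1 + u ^ 2 ≤ 10 := by nlinarith
    have hb : 25 / 6 ≤ 125 / 3 / (1 + u ^ 2) := by
      rw [le_div_iff₀ h1]; nlinarith
    have hF : u + 3 ≤ Fthin u := by unfold Fthin; linarith
    rw [abs_of_nonneg (by linarith : 0 ≤ u + 3), abs_of_nonneg (by linarith : 0 ≤ Fthin u)]
    linarith
  · have hb : 0 < 125 / 3 / (1 + u ^ 2) := by positivity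
    have hF : u - 7 / 6 < Fthin u := by unfold Fthin; linarith
    rw [abs_of_nonneg (by linarith : 0 ≤ u + 3), abs_of_pos (by linarith : 0 < Fthin u)]
    linarith

/-! ### Calculus of `F` -/

/-- `F` has derivative `F′`. -/
theorem hasDerivAt_Fthin (u : ℝ) : HasDerivAt Fthin (Fthin' u) u := by
  have hden : HasDerivAt (fun x : ℝ => 1 + x ^ 2) (2 * u) u := by
    have := (hasDerivAt_pow 2 u).const_add 1
    simpa using this
  have hne : 1 + u ^ 2 ≠ 0 := by positivity
  have h1 : HasDerivAt (fun x : ℝ => 125 / 3 * (1 + x ^ 2)⁻¹) (125 / 3 * (-(2 * u) / (1 + u ^ 2) ^ 2)) u :=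
    (hden.inv hne).const_mul (125 / 3)
  have h3 : HasDerivAt (fun x : ℝ => 125 / 3 * (1 + x ^ 2)⁻¹ + x - 7 / 6)
      (125 / 3 * (-(2 * u) / (1 + u ^ 2) ^ 2) + 1) u := (h1.add (hasDerivAt_id u)).sub_const (7 / 6)
  have hF : Fthin = fun x : ℝ => 125 / 3 * (1 + x ^ 2)⁻¹ + x - 7 / 6 := by
    funext x; simp only [Fthin]; ring
  rw [hF]
  convert h3 using 1
  simp only [Fthin']; ring

/-- `deriv F = F′`. -/
theorem deriv_Fthin (u : ℝ) : deriv Fthin u = Fthin' u := (hasDerivAt_Fthin u).deriv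

/-- SUPERCRITICAL SLOPE at the zero: `F′(−3) = 7/2` exactly (so `W′(s₀) = 7/4 = 3/2 + 1/4`). -/
theorem Fthin'_neg_three : Fthin' (-3) = 7 / 2 := by norm_num [Fthin']

/-- Crude global slope bound `|F′(u)| ≤ 128/3` (the sharp value is `1 + (250/3)·9/(16√3) ≈ 28.07`). -/
theorem abs_Fthin'_le (u : ℝ) : |Fthin' u| ≤ 128 / 3 := by
  have h1 : 0 < 1 + u ^ 2 := by positivity
  have h2 : 0 < (1 + u ^ 2) ^ 2 := by positivity
  have key : |u| ≤ (1 + u ^ 2) ^ 2 / 2 := by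
    have hu : |u| ≤ (1 + u ^ 2) / 2 := by
      rw [abs_le]; constructor <;> nlinarith [sq_nonneg (u + 1), sq_nonneg (u - 1)]
    have hsq : (1 + u ^ 2) / 2 ≤ (1 + u ^ 2) ^ 2 / 2 := by nlinarith
    exact hu.trans hsq
  have hq : |250 / 3 * u / (1 + u ^ 2) ^ 2| ≤ 125 / 3 := by
    rw [abs_div, abs_mul, abs_of_pos h2, abs_of_pos (by norm_num : (0:ℝ) < 250 / 3), div_le_iff₀ h2]
    nlinarith
  have : |Fthin' u| ≤ |(1:ℝ)| + |250 / 3 * u / (1 + u ^ 2) ^ 2| := by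
    simpa [Fthin'] using abs_sub (1:ℝ) (250 / 3 * u / (1 + u ^ 2) ^ 2)
  have h1' : |(1:ℝ)| = 1 := abs_one
  linarith

/-! ### The scaled slip `W(s) = (1/12)·F(6s)` of the exact datum -/

/-- `W(s) = 0 ↔ s = −1/2`. -/
theorem Wthin_eq_zero_iff {s : ℝ} : Wthin s = 0 ↔ s = -1 / 2 := by
  have h : Wthin s = 0 ↔ Fthin (6 * s) = 0 := by
    constructor
    · intro h; simpa [Wthin] using h
    · intro h; simp [Wthin, h]
  rw [h, Fthin_eq_zero_iff]
  constructor <;> intro h' <;> linarith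

/-- Transversality with `mw = 1/10`: `|s + 1/2|/10 ≤ |W(s)|`. -/
theorem Wthin_transversal (s : ℝ) : |s - (-1 / 2)| / 10 ≤ |Wthin s| := by
  have hF := Fthin_transversal (6 * s)
  have h6 : |6 * s + 3| = 6 * |s - (-1 / 2)| := by
    rw [show 6 * s + 3 = 6 * (s - (-1 / 2)) by ring, abs_mul, abs_of_pos (by norm_num : (0:ℝ) < 6)]
  have hW : |Wthin s| = 1 / 12 * |Fthin (6 * s)| := by
    rw [Wthin, abs_mul, abs_of_pos (by norm_num : (0:ℝ) < 1 / 12)]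
  rw [hW]; rw [h6] at hF; linarith

/-- `W` has derivative `½·F′(6s)`. -/
theorem hasDerivAt_Wthin (s : ℝ) : HasDerivAt Wthin (1 / 2 * Fthin' (6 * s)) s := by
  have hin : HasDerivAt (fun x : ℝ => 6 * x) 6 s := by
    simpa using (hasDerivAt_id s).const_mul (6:ℝ)
  have hcomp : HasDerivAt (fun x : ℝ => Fthin (6 * x)) (Fthin' (6 * s) * 6) s :=
    HasDerivAt.comp s (hasDerivAt_Fthin (6 * s)) hin
  have h : HasDerivAt (fun x : ℝ => 1 / 12 * Fthin (6 * x)) (1 / 12 * (Fthin' (6 * s) * 6)) s :=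
    hcomp.const_mul (1 / 12 : ℝ)
  have e : (1 / 12 : ℝ) * (Fthin' (6 * s) * 6) = 1 / 2 * Fthin' (6 * s) := by ring
  rw [e] at h
  exact h

/-- Supercritical slope at the zero: `W′(−1/2) = 7/4 = 3/2 + 1/4`. -/
theorem deriv_Wthin_zero : deriv Wthin (-1 / 2) = 3 / 2 + 1 / 4 := by
  rw [(hasDerivAt_Wthin (-1 / 2)).deriv]
  have : (6 : ℝ) * (-1 / 2) = -3 := by norm_num
  rw [this, Fthin'_neg_three]; norm_num

/-- Global slope bound with `Λ = 22`: `|W′(s)| ≤ 22`. -/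
theorem abs_deriv_Wthin_le (s : ℝ) : |deriv Wthin s| ≤ 22 := by
  rw [(hasDerivAt_Wthin s).deriv, abs_mul, abs_of_pos (by norm_num : (0:ℝ) < 1 / 2)]
  have := abs_Fthin'_le (6 * s)
  linarith

/-- The S1 checklist for the exact datum's slip, bundled: zero at `s₀ = −1/2`, uniqueness, `mw = 1/10`,
slope `3/2 + δ` with `δ = 1/4`, `|W′| ≤ Λ = 22`. -/
theorem Wthin_datum_facts :
    Wthin (-1 / 2) = 0 ∧ (∀ s, Wthin s = 0 → s = -1 / 2) ∧ (∀ s, 1 / 10 * |s - (-1 / 2)| ≤ |Wthin s|) ∧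
      3 / 2 + 1 / 4 ≤ deriv Wthin (-1 / 2) ∧ (∀ s, |deriv Wthin s| ≤ 22) := by
  refine ⟨Wthin_eq_zero_iff.mpr rfl, fun s h => Wthin_eq_zero_iff.mp h, fun s => ?_, (deriv_Wthin_zero).symm.le,
    abs_deriv_Wthin_le⟩
  have := Wthin_transversal s
  linarith

end Summit.NavierStokesRegularity.NavierStokesRegularity.Cruxes.SkeletonJ1.NearStraightNewton
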